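import Summits.ABC.IUTFork.LDHGenuineStepVBound
import Summits.ABC.IUTFork.LDHSlotResidue
import HarnessLib

/-!
# The fork at [IUTchIII] Corollary 3.12, L-DH level: [IUTchIV] Thm. 1.10 Step (v) for the GENUINE datum WITHOUT
# slot-constancy — the K-level constant (V) PLUS THE (Ind1) SLOT RESIDUE is admissible
# (abc-iut cell, crux ThetaPartII = stmt-ABC-19678, child (ii′) `stub_hullVolume`: the general regime, quantified)

Record-only file (D-0012) of the abc-iut cell (WAVE-3 discharge seat abc-iut-c312-d1, gen 4); TAKES NO SIDE.
Mochizuki, *Inter-universal Teichmüller theory IV* (RIMS ms Apr. 2020 = PRIMS **57** (2021)), proof of Thm. 1.10,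
Step (v) pp. 27–29: "“`i†`” to be `j ∈ S^±_{j+1}`; “`λ`” to be … “`ord(−)`” of the element `q̲_{v_j}^{j²}`", "unlike
the other terms …, “`λ`” is asymmetric with respect to the choice of “`i† ∈ I`” … after symmetrizing with respect
to the choice of “`i† ∈ I`” in `S^±_{j+1}`, this upper bound may be written in the form “`β_e⃗`” … after passing to
weighted averages, the operation of symmetrizing … does not affect the computation of the upper bound";
Dupuy–Hilado, arXiv:2004.13228 §4.7 ((Ind1) as permutations of the tensor factors), §4.11–4.12 (`U_Θ`, hull).

THE POINT. Under the cell's typed (Ind1) (factor permutations, `GenuineLogTheta.possibleImages`) the `e⃗`-component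
of the hull of `U_Θ` sees the theta gain at the LEAST divisible slot of the collection `e⃗`, not at the last slot
`i† = j` (plan/c312/STEPV-IND1-NOTE.md; kernel: abc-iut-c312-d1 `MultiradialRegionInd1Bound`, abc-iut-S8
`MultiradialRegionSlotBound` / `LDHSlotResidue`). abc-iut-S8's **slot residue** `slotResidue(P_Θ; T) = Σ_p (1/ℓ⋇)
Σ_j Σ_{v⃗} (θ_j(v_j) − min_a θ_j(v_a))·Π Pr ≥ 0` (`PilotSlotResidue`) is a LOWER bound for every admissible
constant: `I.HullEstimateOf δ ⟹ slotResidue ≤ δ` (`DHData.slotResidue_le_of_hullEstimateOf`, p418005). THIS FILE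
proves the matching UPPER bound for every genuine Θ-volume input `I` (NO slot-constancy hypothesis):

  `I.HullEstimateOf ((l+1)/4·{(1 + 4/l)·dK + (4/l)·sQ + (20/3)·log(2^12·3^3·5·e_mod·l)·sLe} + slotResidue(P_Θ; T(I)))`

for any `dK, sQ, sLe` dominating the different sum, `Σ_{p∈T(I)} log p`, `#{p ∈ T(I) : p ≤ e*_mod·l}` and the
(R4)-shape tameness input at `e_mod` — i.e. (V) of `LDHGenuineStepVBound` with the residue added. So the admissible
constants of a genuine datum are PINNED between `slotResidue` and `slotResidue + δ_K` (`δ_K` the print-shaped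
Steps (v)–(viii) constant, `≤ B_III(P,l)` by abc-iut-S3's `Cor22.deltaK_le_BIII`); the route's child (ii′)
`Cor22.HullVolumeAtDatum P l B_III(P,l)` therefore holds at `(P,l)` as soon as `slotResidue(T) ≤ B_III(P,l) − δ_K(T)`
for its data `T`, and fails as soon as `slotResidue(T) > B_III(P,l)` for one datum: VERDICT RISK 7 ([IUTchIV] Step
(v)'s symmetrisation sentence under the typed (Ind1)) is exactly the size of the slot residue.
Route of proof: abc-iut-c312-d1's `λ_min` form `negLogThetaNonarch_le_min` (`LDHGenuineStepVSum`) with the canonical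
local data; `ndegLgpSlotMin_eq_sum_procAvg_minAvg` identifies its `q`-term `Σ_p (1/ℓ⋇)Σ_j (j²/2l)·m_j(p)` with S8's
least-slot aggregate `ndegLgpSlotMin(P_Θ; T(I))` (`θ_j(v) = (j²/2l)·log(q_v)`, `thetaValue_eq`; the weighted average
of Rmk. 1.7.1 IS the Dupuy–Hilado expectation, `DstLocal.wavg_eq_sum_mul_weight`); S8's `DHData.slotResidue_eq`
(`slotResidue = deĝ̲_lgp(P_Θ) − ndegLgpSlotMin`). Decls: `ndegLgpSlotMin_eq_sum_procAvg_minAvg`,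
`hullEstimateOf_ofInput_min_explicit` (the `λ_min` form as `HullEstimateOf (δ_K + slotResidue)` with the canonical
`δ_K(I)`), `hullEstimateOf_ofInput_stepV_add_slotResidue` (free `dK, sQ, sLe`, (R4) at `e_mod`),
`…_of_iotaForm` (free `L = l`, abc-iut-S1's `ι`-form of (R4)), `…_of_iotaForm_pi` (`sLe := π(e*_mod·l)`).
[cite: Mochizuki2012, IUTchIV Thm. 1.10 proof Step (v) p. 27–29] [cite: DupuyHilado2025, §4.7, §4.11, §4.12]
[claim: Mochizuki2012, status: disputed] HONEST SCOPE: nothing asserts [IUTchIII] Cor. 3.12 or decides Step (v);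
these are consequences of the typed definitions (typed ≠ endorsed).
-/

noncomputable section

namespace Summit.ABC.IUTFork

namespace DHData

open Finset Literature.IUT.LogVolume Literature.IUT.LogVolume.Thm110Local NumberField IsDedekindDomain

variable {F₀ : Type} [Field F₀] [NumberField F₀] {K : Type} [Field K] [NumberField K] [Algebra F₀ K]
variable (I : ThetaVolumeInput F₀ K)

omit [NumberField F₀] [NumberField K] in
/-- Re-indexing the procession: `Σ_{i=0}^{ℓ⋇−1} f(i+1) = Σ_{j=1}^{ℓ⋇} f(j)`. [folklore] -/
private theorem sum_fin_succ_eq_sum_Icc (n : ℕ) (f : ℕ → ℝ) :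
    ∑ i : Fin n, f ((i : ℕ) + 1) = ∑ j ∈ Icc 1 n, f j := by
  induction n with
  | zero => simp
  | succ k ih =>
    rw [Fin.sum_univ_castSucc, Finset.sum_Icc_succ_top (by omega), ← ih]
    simp

/-- The least slot value of a collection is `(j²/2l)·min_k log(q_{v_k})` (`θ_j(v) = (j²/2l)·log(q_v)` is a
nonnegative multiple of the canonical `log(q_v)`). [cite: DupuyHilado2025, §3.3] -/
theorem inf'_slotValue_eq (i : Fin I.X.lstar) {p : ℕ} (e : Fin ((i : ℕ) + 1 + 1) → placesOver F₀ p) :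
    Finset.univ.inf' Finset.univ_nonempty (fun k => I.X.slotValue i (e k).1) =
      (((i : ℕ) : ℝ) + 1) ^ 2 / (2 * I.X.l) * DstLocal.tupleMin ((ofInput I).logQloc p) e := by
  have hθ : ∀ k, I.X.slotValue i (e k).1 = (((i : ℕ) : ℝ) + 1) ^ 2 / (2 * I.X.l) * (ofInput I).logQloc p (e k) :=
    fun k => thetaValue_eq I i (e k)
  have hc : 0 ≤ (((i : ℕ) : ℝ) + 1) ^ 2 / (2 * I.X.l) := by positivity
  unfold DstLocal.tupleMin
  refine le_antisymm ?_ ?_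
  · obtain ⟨k₀, -, hk₀⟩ := Finset.exists_mem_eq_inf' Finset.univ_nonempty (fun k => (ofInput I).logQloc p (e k))
    rw [hk₀, ← hθ k₀]
    exact Finset.inf'_le _ (Finset.mem_univ k₀)
  · obtain ⟨k₁, -, hk₁⟩ := Finset.exists_mem_eq_inf' Finset.univ_nonempty (fun k => I.X.slotValue i (e k).1)
    rw [hk₁, hθ k₁]
    exact mul_le_mul_of_nonneg_left (Finset.inf'_le _ (Finset.mem_univ k₁)) hc

/-- **The least-slot aggregate IS the `λ_min` `q`-term**: for local data on the support primes with the weights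
`λ_v = n_v` and the canonical `log(q_v)`, `ndegLgpSlotMin(P_Θ; T(I)) = Σ_{p∈T(I)} (1/ℓ⋇)·Σ_{j=1}^{ℓ⋇} (j²/2l)·m_j(p)`,
`m_j(p)` the weighted average over `(j+1)`-collections of `min_a log(q_{v_a})` (abc-iut-S3's `DstLocal.minAvg`).
[cite: DupuyHilado2025, §3.6, §4.7] [cite: Mochizuki2012, IUTchIV Rmk. 1.7.1 p. 17] -/
theorem ndegLgpSlotMin_eq_sum_procAvg_minAvg (Dloc : (p : ℕ) → DstLocal (placesOver F₀ p))
    (hlam : ∀ p ∈ I.supportPrimes, ∀ v : placesOver F₀ p, (Dloc p).lam v = localDegree F₀ v.1)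
    (hQ : ∀ p ∈ I.supportPrimes, ∀ v : placesOver F₀ p, (Dloc p).logQ v = (ofInput I).logQloc p v) :
    I.X.ndegLgpSlotMin I.supportPrimes =
      ∑ p ∈ I.supportPrimes,
        procAvg I.X.lstar (fun j => (j : ℝ) ^ 2 / (2 * (I.X.l : ℝ)) * (Dloc p).minAvg j) := by
  unfold PilotData.ndegLgpSlotMin procAvg
  refine Finset.sum_congr rfl fun p hp => ?_
  haveI : Fact p.Prime := ⟨I.prime_of_mem_supportPrimes hp⟩
  congr 1
  rw [← sum_fin_succ_eq_sum_Icc I.X.lstar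
    (fun j => (j : ℝ) ^ 2 / (2 * (I.X.l : ℝ)) * (Dloc p).minAvg j)]
  refine Finset.sum_congr rfl fun i _ => ?_
  have hQf : (Dloc p).logQ = (ofInput I).logQloc p := funext (hQ p hp)
  rw [DstLocal.minAvg, (Dloc p).wavg_eq_sum_mul_weight (hlam p hp), Finset.mul_sum, hQf]
  refine Finset.sum_congr rfl fun e _ => ?_
  rw [inf'_slotValue_eq I i e, ← mul_assoc]
  push_cast
  ring

/-! ## `HullEstimateOf (δ_K + slotResidue)` — no slot-constancy -/

/-- **The `λ_min` form as a hull estimate, canonical constant**: for EVERY genuine input (no slot-constancy) and the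
(R4)-shape tameness input with threshold `N` and size `l*`, `HullEstimateOf I (δ_K(I) + slotResidue(P_Θ; T(I)))` with
`δ_K(I) = (l+1)/4·{(1+4/l)·Σ_{p∈T(I)}(Σ_{v|p} n_v·d(K_{v̲}))/[F_mod:ℚ]·log p + (4/l)·Σ_{p∈T(I)} log p + (20/3)·l*·#{p ∈
T(I) : p ≤ N}}` — the constant of `hullEstimateOf_ofInput_explicit` PLUS abc-iut-S8's slot residue.
[cite: Mochizuki2012, IUTchIV Thm. 1.10 proof Steps (v)–(viii) p. 27–30] [cite: DupuyHilado2025, §4.7, §4.12]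
[claim: Mochizuki2012, status: disputed] -/
theorem hullEstimateOf_ofInput_min_explicit (N : ℕ) {lmod : ℝ} (hlmod : 0 ≤ lmod)
    (hR4 : ∀ (p : ℕ) [hp : Fact p.Prime], p ∈ I.supportPrimes → ∀ v : placesOver F₀ p,
      p - 2 < absRamificationIdx p ((I.σ.localFieldFamily p hp.out).k v) →
      p ≤ N ∧ 3 + Real.log (absRamificationIdx p ((I.σ.localFieldFamily p hp.out).k v)) ≤ 4 * lmod) :
    I.HullEstimateOf
      (((I.X.l : ℝ) + 1) / 4 * ((1 + 4 / (I.X.l : ℝ)) *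
          (∑ p ∈ I.supportPrimes, if hp : p.Prime then haveI : Fact p.Prime := ⟨hp⟩
            (∑ v : placesOver F₀ p, (localDegree F₀ v.1 : ℝ) *
              differentOrd p ((I.σ.localFieldFamily p hp).k v)) / Module.finrank ℚ F₀ * Real.log p else 0)
        + 4 / (I.X.l : ℝ) * (∑ p ∈ I.supportPrimes, Real.log p)
        + 20 / 3 * lmod * ((I.supportPrimes.filter (· ≤ N)).card : ℝ))
        + I.X.slotResidue I.supportPrimes) := by
  classical
  -- the canonical local data at every index `p` (as in `hullEstimateOf_ofInput_explicit`)
  let Dloc : (p : ℕ) → DstLocal (placesOver F₀ p) := fun p =>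
    { lam := fun v => localDegree F₀ v.1
      lam_pos := fun v => by exact_mod_cast localDegree_pos F₀ v.1
      logDK := fun v => if hp : p.Prime then haveI : Fact p.Prime := ⟨hp⟩
        differentOrd p ((I.σ.localFieldFamily p hp).k v) * Real.log p else 0
      logDK_nonneg := fun v => by
        split_ifs with hp
        · haveI : Fact p.Prime := ⟨hp⟩
          exact mul_nonneg (differentOrd_nonneg p _) (Real.log_natCast_nonneg p)
        · exact le_rfl
      logQ := fun v => (ofInput I).logQloc p v
      logQ_nonneg := fun v => (ofInput I).logQloc_nonneg p v
      logp := Real.log p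
      logp_nonneg := Real.log_natCast_nonneg p
      iota := if p ≤ N then 1 else 0
      iota_nonneg := by split_ifs <;> norm_num }
  have hlam : ∀ p ∈ I.supportPrimes, ∀ v : placesOver F₀ p, (Dloc p).lam v = localDegree F₀ v.1 :=
    fun p _ v => rfl
  have hDK : ∀ (p : ℕ) [hp : Fact p.Prime], p ∈ I.supportPrimes → ∀ v : placesOver F₀ p,
      differentOrd p ((I.σ.localFieldFamily p hp.out).k v) * Real.log p ≤ (Dloc p).logDK v := by
    intro p hp _ v
    show _ ≤ (if hp : p.Prime then _ else _)
    rw [dif_pos hp.out]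
  have hR4' : ∀ (p : ℕ) [hp : Fact p.Prime], p ∈ I.supportPrimes → ∀ v : placesOver F₀ p,
      p - 2 < absRamificationIdx p ((I.σ.localFieldFamily p hp.out).k v) →
      3 + Real.log (absRamificationIdx p ((I.σ.localFieldFamily p hp.out).k v)) ≤ 4 * (Dloc p).iota * lmod := by
    intro p hp hpT v hv
    obtain ⟨hpN, hle⟩ := hR4 p hpT v hv
    show _ ≤ 4 * (if p ≤ N then (1 : ℝ) else 0) * lmod
    rw [if_pos hpN, mul_one]
    exact hle
  -- the `λ_min` form
  have h := negLogThetaNonarch_le_min I Dloc hlam hlmod hDK (fun p _ v => le_rfl) (fun p _ => le_rfl) hR4'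
  -- its `q`-term is the least-slot aggregate; the residue identity of abc-iut-S8
  have hmin := ndegLgpSlotMin_eq_sum_procAvg_minAvg I Dloc hlam (fun p _ v => rfl)
  have hres : I.X.slotResidue I.supportPrimes =
      LgpDivisor.ndegLgp I.X.thetaPilot - I.X.ndegLgpSlotMin I.supportPrimes := (ofInput I).slotResidue_eq
  -- identify the three sums of the constant
  have h1 : ∑ p ∈ I.supportPrimes, (Dloc p).avg (Dloc p).logDK =
      ∑ p ∈ I.supportPrimes, if hp : p.Prime then haveI : Fact p.Prime := ⟨hp⟩
        (∑ v : placesOver F₀ p, (localDegree F₀ v.1 : ℝ) *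
          differentOrd p ((I.σ.localFieldFamily p hp).k v)) / Module.finrank ℚ F₀ * Real.log p else 0 := by
    refine Finset.sum_congr rfl fun p hp => ?_
    have hp' : p.Prime := I.prime_of_mem_supportPrimes hp
    haveI : Fact p.Prime := ⟨hp'⟩
    have hDKv : ∀ v : placesOver F₀ p,
        (Dloc p).logDK v = differentOrd p ((I.σ.localFieldFamily p hp').k v) * Real.log p := by
      intro v
      show (if hp : p.Prime then _ else _) = _
      rw [dif_pos hp']
    rw [dif_pos hp', avg_eq_sum_div (Dloc p) (fun v => rfl), div_mul_eq_mul_div, Finset.sum_mul]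
    congr 1
    exact Finset.sum_congr rfl fun v _ => by rw [hDKv v]; ring
  have h2 : ∑ p ∈ I.supportPrimes, (Dloc p).logp = ∑ p ∈ I.supportPrimes, Real.log p := rfl
  have h3 : ∑ p ∈ I.supportPrimes, (Dloc p).iota = ((I.supportPrimes.filter (· ≤ N)).card : ℝ) := by
    show ∑ p ∈ I.supportPrimes, (if p ≤ N then (1 : ℝ) else 0) = _
    rw [Finset.sum_boole]
  unfold ThetaVolumeInput.HullEstimateOf
  rw [← h1, ← h3, hres, hmin]
  linarith

/-- **(V) + slot residue, for EVERY genuine input**: with the (R4)-shape input at `e_mod` and any `dK, sQ, sLe`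
dominating the different sum, `Σ_{p∈T(I)} log p` and `#{p ∈ T(I) : p ≤ e*_mod·l}`:
`I.HullEstimateOf ((l+1)/4·{(1 + 4/l)·dK + (4/l)·sQ + (20/3)·log(2^12·3^3·5·e_mod·l)·sLe} + slotResidue(P_Θ; T(I)))` —
the UPPER twin of abc-iut-S8's `slotResidue_le_of_hullEstimateOf`. Under slot-constancy the residue is `0`
(`PilotData.slotResidue_eq_zero_of_const`) and this is `hullEstimateOf_ofInput_stepV`.
[cite: Mochizuki2012, IUTchIV Thm. 1.10 proof Steps (v)–(viii) p. 27–30] [cite: DupuyHilado2025, §4.7, §4.12]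
[claim: Mochizuki2012, status: disputed] -/
theorem hullEstimateOf_ofInput_stepV_add_slotResidue (emod : ℕ) (hemod : 1 ≤ emod) {dK sQ sLe : ℝ}
    (hdK : (∑ p ∈ I.supportPrimes, if hp : p.Prime then haveI : Fact p.Prime := ⟨hp⟩
            (∑ v : placesOver F₀ p, (localDegree F₀ v.1 : ℝ) *
              differentOrd p ((I.σ.localFieldFamily p hp).k v)) / Module.finrank ℚ F₀ * Real.log p else 0) ≤ dK)
    (hsQ : ∑ p ∈ I.supportPrimes, Real.log p ≤ sQ)
    (hsLe : ((I.supportPrimes.filter (· ≤ 2 ^ 12 * 3 ^ 3 * 5 * emod * I.X.l)).card : ℝ) ≤ sLe)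
    (hR4 : ∀ (p : ℕ) [hp : Fact p.Prime], p ∈ I.supportPrimes → ∀ v : placesOver F₀ p,
      p - 2 < absRamificationIdx p ((I.σ.localFieldFamily p hp.out).k v) →
      p ≤ 2 ^ 12 * 3 ^ 3 * 5 * emod * I.X.l ∧
        3 + Real.log (absRamificationIdx p ((I.σ.localFieldFamily p hp.out).k v)) ≤
          4 * Real.log ((2 : ℝ) ^ 12 * 3 ^ 3 * 5 * emod * I.X.l)) :
    I.HullEstimateOf
      (((I.X.l : ℝ) + 1) / 4 * ((1 + 4 / (I.X.l : ℝ)) * dK + 4 / (I.X.l : ℝ) * sQ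
        + 20 / 3 * Real.log ((2 : ℝ) ^ 12 * 3 ^ 3 * 5 * emod * I.X.l) * sLe)
        + I.X.slotResidue I.supportPrimes) := by
  have hl1 : 1 ≤ I.X.l := le_trans (by norm_num) I.X.five_le_l
  have hlmod := lstarMod_nonneg hemod hl1
  have h := hullEstimateOf_ofInput_min_explicit I (2 ^ 12 * 3 ^ 3 * 5 * emod * I.X.l) hlmod hR4
  refine hullEstimateOf_mono I h ?_
  have hl : (0 : ℝ) < I.X.l := by exact_mod_cast (lt_of_lt_of_le (by norm_num) hl1)
  have hc0 : (0 : ℝ) ≤ ((I.X.l : ℝ) + 1) / 4 := by positivity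
  have hc1 : (0 : ℝ) ≤ 1 + 4 / (I.X.l : ℝ) := by positivity
  have hc2 : (0 : ℝ) ≤ 4 / (I.X.l : ℝ) := by positivity
  have hc3 : (0 : ℝ) ≤ 20 / 3 * Real.log ((2 : ℝ) ^ 12 * 3 ^ 3 * 5 * emod * I.X.l) := by positivity
  have e3 : 20 / 3 * Real.log ((2 : ℝ) ^ 12 * 3 ^ 3 * 5 * emod * I.X.l) *
      ((I.supportPrimes.filter (· ≤ 2 ^ 12 * 3 ^ 3 * 5 * emod * I.X.l)).card : ℝ) ≤
      20 / 3 * Real.log ((2 : ℝ) ^ 12 * 3 ^ 3 * 5 * emod * I.X.l) * sLe := mul_le_mul_of_nonneg_left hsLe hc3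
  have e1 := mul_le_mul_of_nonneg_left hdK hc1
  have e2 := mul_le_mul_of_nonneg_left hsQ hc2
  have key : (1 + 4 / (I.X.l : ℝ)) *
        (∑ p ∈ I.supportPrimes, if hp : p.Prime then haveI : Fact p.Prime := ⟨hp⟩
          (∑ v : placesOver F₀ p, (localDegree F₀ v.1 : ℝ) *
            differentOrd p ((I.σ.localFieldFamily p hp).k v)) / Module.finrank ℚ F₀ * Real.log p else 0)
        + 4 / (I.X.l : ℝ) * (∑ p ∈ I.supportPrimes, Real.log p)
        + 20 / 3 * Real.log ((2 : ℝ) ^ 12 * 3 ^ 3 * 5 * emod * I.X.l) *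
          ((I.supportPrimes.filter (· ≤ 2 ^ 12 * 3 ^ 3 * 5 * emod * I.X.l)).card : ℝ) ≤
      (1 + 4 / (I.X.l : ℝ)) * dK + 4 / (I.X.l : ℝ) * sQ
        + 20 / 3 * Real.log ((2 : ℝ) ^ 12 * 3 ^ 3 * 5 * emod * I.X.l) * sLe := by linarith
  have := mul_le_mul_of_nonneg_left key hc0
  linarith

/-- **The same with the prime as a free natural number `L = l` and (R4) in abc-iut-S1's `ι`-form** (for the
datum-level consumers: `DHData.hullEstimateOf_ofInput_stepV_add_slotResidue_of_iotaForm T.I T.l_eq …` under the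
datum's `letI` preamble, then abc-iut-S3's `Cor22.deltaK_le_BIII` gives `T.HullEstimateOf (B_III(P,l) + slotResidue(T))`).
[cite: Mochizuki2012, IUTchIV Thm. 1.10 proof Steps (iii), (v)–(viii) p. 25–30] [claim: Mochizuki2012, status: disputed] -/
theorem hullEstimateOf_ofInput_stepV_add_slotResidue_of_iotaForm {L : ℕ} (hL : I.X.l = L) (emod : ℕ)
    (hemod : 1 ≤ emod) {dK sQ sLe : ℝ}
    (hdK : (∑ p ∈ I.supportPrimes, if hp : p.Prime then haveI : Fact p.Prime := ⟨hp⟩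
            (∑ v : placesOver F₀ p, (localDegree F₀ v.1 : ℝ) *
              differentOrd p ((I.σ.localFieldFamily p hp).k v)) / Module.finrank ℚ F₀ * Real.log p else 0) ≤ dK)
    (hsQ : ∑ p ∈ I.supportPrimes, Real.log p ≤ sQ)
    (hsLe : ((I.supportPrimes.filter (· ≤ 2 ^ 12 * 3 ^ 3 * 5 * emod * L)).card : ℝ) ≤ sLe)
    (hR4 : ∀ (p : ℕ) [hp : Fact p.Prime], p ∈ I.supportPrimes → ∀ v : placesOver F₀ p,
      p - 2 < absRamificationIdx p ((I.σ.localFieldFamily p hp.out).k v) →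
      3 + Real.log (absRamificationIdx p ((I.σ.localFieldFamily p hp.out).k v)) ≤
        4 * (if p ≤ 2 ^ 12 * 3 ^ 3 * 5 * emod * L then (1 : ℝ) else 0) *
          Real.log (((2 ^ 12 * 3 ^ 3 * 5 * emod : ℕ) : ℝ) * L)) :
    I.HullEstimateOf
      (((L : ℝ) + 1) / 4 * ((1 + 4 / (L : ℝ)) * dK + 4 / (L : ℝ) * sQ
        + 20 / 3 * Real.log ((2 : ℝ) ^ 12 * 3 ^ 3 * 5 * emod * L) * sLe)
        + I.X.slotResidue I.supportPrimes) := by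
  subst hL
  exact hullEstimateOf_ofInput_stepV_add_slotResidue I emod hemod hdK hsQ hsLe
    (fun p hp hpT v hv => r4_of_iotaForm (hR4 p hpT v) hv)

/-- **The same with `sQ := Σ_{p∈T(I)} log p` and `sLe := π(e*_mod·l)`** (print's values; abc-iut-S3's `hsQle` is then
Step (iii) on the genuine support primes and `hsLele` is `le_rfl`).
[cite: Mochizuki2012, IUTchIV Thm. 1.10 proof Steps (iii), (v)–(viii) p. 25–30] [claim: Mochizuki2012, status: disputed] -/
theorem hullEstimateOf_ofInput_stepV_add_slotResidue_of_iotaForm_pi {L : ℕ} (hL : I.X.l = L) (emod : ℕ)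
    (hemod : 1 ≤ emod) {dK : ℝ}
    (hdK : (∑ p ∈ I.supportPrimes, if hp : p.Prime then haveI : Fact p.Prime := ⟨hp⟩
            (∑ v : placesOver F₀ p, (localDegree F₀ v.1 : ℝ) *
              differentOrd p ((I.σ.localFieldFamily p hp).k v)) / Module.finrank ℚ F₀ * Real.log p else 0) ≤ dK)
    (hR4 : ∀ (p : ℕ) [hp : Fact p.Prime], p ∈ I.supportPrimes → ∀ v : placesOver F₀ p,
      p - 2 < absRamificationIdx p ((I.σ.localFieldFamily p hp.out).k v) →
      3 + Real.log (absRamificationIdx p ((I.σ.localFieldFamily p hp.out).k v)) ≤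
        4 * (if p ≤ 2 ^ 12 * 3 ^ 3 * 5 * emod * L then (1 : ℝ) else 0) *
          Real.log (((2 ^ 12 * 3 ^ 3 * 5 * emod : ℕ) : ℝ) * L)) :
    I.HullEstimateOf
      (((L : ℝ) + 1) / 4 * ((1 + 4 / (L : ℝ)) * dK + 4 / (L : ℝ) * (∑ p ∈ I.supportPrimes, Real.log p)
        + 20 / 3 * Real.log ((2 : ℝ) ^ 12 * 3 ^ 3 * 5 * emod * L)
          * (Nat.primeCounting (2 ^ 12 * 3 ^ 3 * 5 * emod * L) : ℝ))
        + I.X.slotResidue I.supportPrimes) :=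
  hullEstimateOf_ofInput_stepV_add_slotResidue_of_iotaForm I hL emod hemod hdK le_rfl
    (card_filter_le_of_primeCounting_le I le_rfl) hR4

end DHData

end Summit.ABC.IUTFork

end
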